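import Summits.QuantumFields.BalabanUV.T4Continuum.Support.VariationalVectorInterpolant
import Summits.QuantumFields.BalabanUV.T4Continuum.Support.VariationalVectorForm

/-!
# T⁴ programme, spine node NE2 (U1a), lane P2 — SUPPLIER LEAF V-ONE FOR E-VALUED 1-FORMS («V-ONE-1F»), file 2: THE FINE COVARIANT CURL OF THE
# COMPETITOR, BOND BY BOND — `L⁻¹ •` coarse curl + face second differences (longitudinal term COMMUTED) + commutator and frame defects

NE2 formalisation swarm `b2b-balaban-t4-ne2-formalise-*`, leaf prover 01 GEN 6 (`prover-b2b-balaban-t4-ne2-formalise-leaf-01-g6-0`); file 2 of the V-ONE-1F line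
(journal INTENT CLAIMS.log 2026-08-20 ≈13:00Z), on top of file 1 `VariationalVectorInterpolant` (`PhiV = Phiv(component) + (lt − wt)(j_ν)•(D_νW)(y,ν)`,
`interpV = U′⋆Φ`, site frames) and of leaf-02-g4's 0-form bond calculus `VariationalColourInterpolant.{Phiv_succ_sub, Rc_Phiv_sub, Rc_cDv_shift, err2v,
cov_diff_split_frame}` BY NAME.  The curl is the road owner's `VariationalVectorForm.{cdV, curlV}` (p216339).

THE STATEMENTS (lattice units; coarse torus `Tor N`, fine `Tor (fine L N)`; `λ_ν := W(·,ν)`; `D` = `cDv N Rc`; `μ ≠ ν` throughout — the longitudinal digit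
never moves inside `curl_{μν}`):
 * in the block (`j_μ + 1 < L`): `Φ_ν(y, j + e_μ) − Φ_ν(y, j) = L⁻¹ • (D_μλ_ν)(y)` EXACTLY (`PhiV_succ_sub`; the tilt is not differentiated);
 * across the `μ`-face (`j_μ + 1 = L`, `j⁰ = j[μ ↦ 0]`): `Rc(y,μ)Φ_ν(y+e_μ, j⁰) − Φ_ν(y,j) = L⁻¹•(D_μλ_ν)(y) + err₂(λ_ν)(y,j,μ) + tiltErr + commErr`
   (`Rc_PhiV_sub`) with `tiltErr = (lt − wt)(j_ν) • (D_νD_μλ_ν)(y)` — the longitudinal face term with the two covariant differences COMMUTED — and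
   `commErr = (lt − wt)(j_ν) • plaq(y,μ,ν)(λ_ν(y+e_μ+e_ν))`, `plaq = Rc(y,μ)Rc(y+e_μ,ν) − Rc(y,ν)Rc(y+e_ν,μ)` (`cDv_comm`: the covariant commutator
   `[D_μ, D_ν]` is ONE plaquette term);
 * **`norm_frame_rem_le`**: `‖D′_μΛ′_ν(x) − U′(x)⋆(geoV + commErr)‖ ≤ m·‖Φ_ν(x + e_μ)‖` under the two FRAME defects of the 0-form files
   (`‖R′(x,μ)U′(x+e_μ)⋆ − U′(x)⋆‖ ≤ m` in the block, `‖R′(x,μ)U′(x+e_μ)⋆ − U′(x)⋆Rc(y,μ)‖ ≤ m` across), `geoV := L⁻¹•(D_μλ_ν)(y) + err₂(λ_ν) + tiltErr`;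
 * **`norm_curlV_interpV_le`**: `‖curl′_{R′}(Λ′)(x,μ,ν)‖ ≤ ‖geoV(μ,ν) − geoV(ν,μ)‖ + ‖commErr(μ,ν)‖ + ‖commErr(ν,μ)‖ + m(‖Φ_ν(x+e_μ)‖ + ‖Φ_μ(x+e_ν)‖)`
   and `geoV(μ,ν) − geoV(ν,μ) = L⁻¹ • curl_{μν}(y) + eV(y,j,μ,ν)` (`geoV_sub_geoV`), `eV` the antisymmetrised face second differences;
 * sizes: `‖tiltErr‖ ≤ (5∕2)‖(D_νD_μλ_ν)(y)‖`, `‖commErr‖ ≤ (5∕2)·p·‖λ_ν(y+e_μ+e_ν)‖` on the face (`‖plaq‖ ≤ p`), `Σ_x‖Φ_ν(x)‖² ≤ (4(1+d²) + 50)·L^d·Σ_y‖λ_ν(y)‖²`.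
File 3 sums the squares (main term constant EXACTLY 1 by the signed cross term); file 4 rescales.

HONEST FRAMING (T4-DAG p. 1).  Model level: `E`-valued 1-forms, site frames `U′`, coarse ∕ fine bond operators `Rc` ∕ `R′` DATA; [folklore] lattice bookkeeping;
nothing printed is a hypothesis; data `def`s `plaq`, `tiltErr`, `commErr`, `geoV`, `eV` only, no `def … : Prop`, no `sorry`; axioms standard.  NE2 NOT proved; spine
PROVED 0∕9; rung (B)+1 finite T⁴ — NOT infinite volume, NOT mass gap, NOT Clay.  HONEST DEPENDENCY (cell, verbatim): continuum YM on T⁴ ⇐ BetaPertH ∧ nine spine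
estimates (0/9 proved); BetaPertH ⇐ (D1) ∧ (D4) ∧ CAP+tail; G-an2-4 gates asym, D1 and NE2/3/4.
-/

noncomputable section

namespace Summit.QuantumFields.BalabanUV.T4Continuum.VariationalVectorOneStep

open Finset
open Literature.MathematicalPhysics.QuantumFieldTheory.Balaban1983to89
open Literature.MathematicalPhysics.QuantumFieldTheory.Balaban1983to89.B5Prop11Plancherel (Tor fine unitVec)
open Literature.MathematicalPhysics.QuantumFieldTheory.Balaban1983to89.B5Block118 (bpt)
open Literature.MathematicalPhysics.QuantumFieldTheory.Balaban1983to89.B5AverageCurlStokes (sum_blocks_real)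
open Summit.QuantumFields.BalabanUV.T4Continuum.ScalarBlockTrialFunction (bpt_add_unitVec_of_lt bpt_add_unitVec_of_eq)
open Summit.QuantumFields.BalabanUV.T4Continuum.VariationalCovariantWeights (wt)
open Summit.QuantumFields.BalabanUV.T4Continuum.VariationalColourFederbush (cDv norm_le_one_of_mem_unitary)
open Summit.QuantumFields.BalabanUV.T4Continuum.VariationalColourInterpolant
  (Phiv err2v Phiv_succ_sub Rc_Phiv_sub Rc_cDv_shift cov_diff_split_frame norm_star_apply_le norm_Phiv_le sum_norm_sq_PhiFv_le)
open Summit.QuantumFields.BalabanUV.T4Continuum.VariationalVectorForm (cdV curlV)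
open Summit.QuantumFields.BalabanUV.T4Continuum.VariationalVectorInterpolant (lt abs_lt_sub_wt_le PhiV PhiFV interpV PhiFV_bpt)

variable {d : ℕ} {E : Type*} [NormedAddCommGroup E] [InnerProductSpace ℂ E] [CompleteSpace E]

/-! ## §1 The commutator is one plaquette term; the face terms of the tilted interpolant -/

section Objects

variable (L : ℕ) [NeZero L] (N : Fin d → ℕ) [∀ μ, NeZero (N μ)] (Rc : Tor N → Fin d → (E →L[ℂ] E)) (W : Tor N → Fin d → E)

/-- the PLAQUETTE DEFECT operator of the coarse bond operators: `plaq(y,μ,ν) = Rc(y,μ)Rc(y+e_μ,ν) − Rc(y,ν)Rc(y+e_ν,μ)`. [folklore] -/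
def plaq (y : Tor N) (μ ν : Fin d) : E →L[ℂ] E := Rc y μ * Rc (y + unitVec N μ) ν - Rc y ν * Rc (y + unitVec N ν) μ

/-- the LONGITUDINAL FACE TERM, COMMUTED: `tiltErr(y,j,μ,ν) = [j_μ + 1 = L]·(lt − wt)(j_ν) • (D_νD_μλ_ν)(y)`. [folklore] -/
def tiltErr (y : Tor N) (j : Fin d → Fin L) (μ ν : Fin d) : E :=
  if (j μ : ℕ) + 1 = L then (((lt L (j ν) - wt L (j ν)) : ℝ) : ℂ) • cDv N Rc (fun z => cDv N Rc (fun z => W z ν) z μ) y ν else 0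

/-- the COMMUTATOR FACE TERM: `commErr(y,j,μ,ν) = [j_μ + 1 = L]·(lt − wt)(j_ν) • plaq(y,μ,ν)(λ_ν(y + e_μ + e_ν))`. [folklore] -/
def commErr (y : Tor N) (j : Fin d → Fin L) (μ ν : Fin d) : E :=
  if (j μ : ℕ) + 1 = L then (((lt L (j ν) - wt L (j ν)) : ℝ) : ℂ) • plaq N Rc y μ ν (W (y + unitVec N μ + unitVec N ν) ν) else 0

/-- the GEOMETRIC INCREMENT of the `ν`-component across the `μ`-bond at offset `j`: `L⁻¹•(D_μλ_ν)(y) + err₂(λ_ν)(y,j,μ) + tiltErr(y,j,μ,ν)`. [folklore] -/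
def geoV (y : Tor N) (j : Fin d → Fin L) (μ ν : Fin d) : E :=
  ((L : ℂ))⁻¹ • cdV N Rc W y μ ν + err2v L N Rc (fun z => W z ν) y j μ + tiltErr L N Rc W y j μ ν

/-- the antisymmetrised face second differences: `eV(y,j,μ,ν) = (err₂(λ_ν)(μ) + tiltErr(μ,ν)) − (err₂(λ_μ)(ν) + tiltErr(ν,μ))`. [folklore] -/
def eV (y : Tor N) (j : Fin d → Fin L) (μ ν : Fin d) : E :=
  (err2v L N Rc (fun z => W z ν) y j μ + tiltErr L N Rc W y j μ ν) - (err2v L N Rc (fun z => W z μ) y j ν + tiltErr L N Rc W y j ν μ)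

omit [NeZero L] [∀ μ, NeZero (N μ)] [CompleteSpace E] in
/-- **THE COVARIANT COMMUTATOR IS ONE PLAQUETTE TERM**: `(D_μD_νf)(y) = (D_νD_μf)(y) + plaq(y,μ,ν)(f(y+e_μ+e_ν))`. [folklore] -/
theorem cDv_comm (f : Tor N → E) (y : Tor N) (μ ν : Fin d) :
    cDv N Rc (fun z => cDv N Rc f z ν) y μ = cDv N Rc (fun z => cDv N Rc f z μ) y ν + plaq N Rc y μ ν (f (y + unitVec N μ + unitVec N ν)) := by
  have e : y + unitVec N ν + unitVec N μ = y + unitVec N μ + unitVec N ν := add_right_comm _ _ _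
  simp only [cDv, plaq, map_sub, sub_apply, mul_apply_eq_comp, e]
  abel

omit [∀ μ, NeZero (N μ)] [CompleteSpace E] in
/-- `geoV(μ,ν) − geoV(ν,μ) = L⁻¹ • curl_{μν}(y) + eV(y,j,μ,ν)`. [folklore] -/
theorem geoV_sub_geoV (y : Tor N) (j : Fin d → Fin L) (μ ν : Fin d) :
    geoV L N Rc W y j μ ν - geoV L N Rc W y j ν μ = ((L : ℂ))⁻¹ • curlV N Rc W y μ ν + eV L N Rc W y j μ ν := by
  simp only [geoV, eV, curlV, smul_sub]
  abel

omit [∀ μ, NeZero (N μ)] [CompleteSpace E] in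
/-- **IN-BLOCK TRANSVERSE INCREMENT, EXACT** (`μ ≠ ν`, `j_μ + 1 < L`): `Φ_ν(y, j[μ ↦ j_μ+1]) − Φ_ν(y, j) = L⁻¹ • (D_μλ_ν)(y)`. [folklore] -/
theorem PhiV_succ_sub {μ ν : Fin d} (hμν : μ ≠ ν) (y : Tor N) (j : Fin d → Fin L) (h : (j μ : ℕ) + 1 < L) :
    PhiV L N Rc W y (Function.update j μ ⟨(j μ : ℕ) + 1, h⟩) ν - PhiV L N Rc W y j ν = ((L : ℂ))⁻¹ • cdV N Rc W y μ ν := by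
  have hν : Function.update j μ (⟨(j μ : ℕ) + 1, h⟩ : Fin L) ν = j ν := Function.update_of_ne hμν.symm _ _
  unfold PhiV
  rw [hν, add_sub_add_right_eq_sub, Phiv_succ_sub L N Rc (fun z => W z ν) y j μ h]
  rfl

omit [∀ μ, NeZero (N μ)] [CompleteSpace E] in
/-- **FACE-CROSSING TRANSVERSE INCREMENT, EXACT** (`μ ≠ ν`, `j_μ + 1 = L`):
`Rc(y,μ)Φ_ν(y+e_μ, j[μ ↦ 0]) − Φ_ν(y,j) = L⁻¹•(D_μλ_ν)(y) + err₂(λ_ν)(y,j,μ) + tiltErr(y,j,μ,ν) + commErr(y,j,μ,ν)`. [folklore] -/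
theorem Rc_PhiV_sub {μ ν : Fin d} (hμν : μ ≠ ν) (y : Tor N) (j : Fin d → Fin L) (h : (j μ : ℕ) + 1 = L) :
    Rc y μ (PhiV L N Rc W (y + unitVec N μ) (Function.update j μ 0) ν) - PhiV L N Rc W y j ν
      = ((L : ℂ))⁻¹ • cdV N Rc W y μ ν + err2v L N Rc (fun z => W z ν) y j μ + tiltErr L N Rc W y j μ ν + commErr L N Rc W y j μ ν := by
  have hν : Function.update j μ (0 : Fin L) ν = j ν := Function.update_of_ne hμν.symm _ _
  have h1 := Rc_Phiv_sub L N Rc (fun z => W z ν) y j μ h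
  have h2 := Rc_cDv_shift N Rc (fun z => W z ν) y μ ν
  have h3 := cDv_comm N Rc (fun z => W z ν) y μ ν
  unfold PhiV
  rw [hν, map_add, map_smul, h2, h3, err2v, if_pos h, tiltErr, if_pos h, commErr, if_pos h]
  have e : Rc y μ (Phiv L N Rc (fun z => W z ν) (y + unitVec N μ) (Function.update j μ 0))
      = Phiv L N Rc (fun z => W z ν) y j + (((L : ℂ))⁻¹ • cDv N Rc (fun z => W z ν) y μ
        + ∑ κ, ((wt L (Function.update j μ (0 : Fin L) κ) : ℝ) : ℂ) • cDv N Rc (fun z => cDv N Rc (fun z => W z ν) z κ) y μ) := by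
    rw [← h1]; abel
  rw [e, smul_add, smul_add]
  simp only [cdV, cDv]
  abel

omit [∀ μ, NeZero (N μ)] [CompleteSpace E] in
/-- off the `μ`-face all three face terms vanish. [folklore] -/
theorem face_terms_zero (y : Tor N) (j : Fin d → Fin L) (μ ν : Fin d) (h : ¬ ((j μ : ℕ) + 1 = L)) :
    err2v L N Rc (fun z => W z ν) y j μ = 0 ∧ tiltErr L N Rc W y j μ ν = 0 ∧ commErr L N Rc W y j μ ν = 0 := by
  refine ⟨?_, ?_, ?_⟩
  · rw [err2v, if_neg h]
  · rw [tiltErr, if_neg h]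
  · rw [commErr, if_neg h]

end Objects

/-! ## §2 The fine covariant curl of the competitor, bond by bond -/

section Bonds

variable (L : ℕ) [NeZero L] (N : Fin d → ℕ) [∀ μ, NeZero (N μ)] {Rc : Tor N → Fin d → (E →L[ℂ] E)} (W : Tor N → Fin d → E)
variable {U' : Tor (fine L N) → (E →L[ℂ] E)} {R' : Tor (fine L N) → Fin d → (E →L[ℂ] E)} {m : ℝ}

/-- **THE FRAME REMAINDER** (`μ ≠ ν`): under the two frame defects,
`‖D′_μΛ′_ν(x) − U′(x)⋆(geoV(y,j,μ,ν) + commErr(y,j,μ,ν))‖ ≤ m·‖Φ_ν(x + e_μ)‖` at `x = L·y + j`. [folklore] -/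
theorem norm_frame_rem_le
    (hin : ∀ (y : Tor N) (j : Fin d → Fin L) (μ : Fin d), (j μ : ℕ) + 1 < L →
      ‖R' (bpt L N y j) μ * star (U' (bpt L N y j + unitVec (fine L N) μ)) - star (U' (bpt L N y j))‖ ≤ m)
    (hcross : ∀ (y : Tor N) (j : Fin d → Fin L) (μ : Fin d), (j μ : ℕ) + 1 = L →
      ‖R' (bpt L N y j) μ * star (U' (bpt L N y j + unitVec (fine L N) μ)) - star (U' (bpt L N y j)) * Rc y μ‖ ≤ m)
    {μ ν : Fin d} (hμν : μ ≠ ν) (y : Tor N) (j : Fin d → Fin L) :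
    ‖cdV (fine L N) R' (interpV L N U' Rc W) (bpt L N y j) μ ν
        - star (U' (bpt L N y j)) (geoV L N Rc W y j μ ν + commErr L N Rc W y j μ ν)‖
      ≤ m * ‖PhiFV L N Rc W (bpt L N y j + unitVec (fine L N) μ) ν‖ := by
  set x := bpt L N y j with hx
  set x' := bpt L N y j + unitVec (fine L N) μ with hx'
  have hcD : cdV (fine L N) R' (interpV L N U' Rc W) x μ ν = R' x μ (star (U' x') (PhiFV L N Rc W x' ν)) - star (U' x) (PhiFV L N Rc W x ν) :=
    rfl
  have hgx : PhiFV L N Rc W x ν = PhiV L N Rc W y j ν := PhiFV_bpt L N Rc W y j ν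
  by_cases hlt : (j μ : ℕ) + 1 < L
  · have hne : ¬ ((j μ : ℕ) + 1 = L) := by omega
    obtain ⟨h0, h1, h2⟩ := face_terms_zero L N Rc W y j μ ν hne
    have hgx' : PhiFV L N Rc W x' ν = PhiV L N Rc W y (Function.update j μ ⟨(j μ : ℕ) + 1, hlt⟩) ν := by
      rw [hx', bpt_add_unitVec_of_lt L N y j μ hlt, PhiFV_bpt]
    have hmain : geoV L N Rc W y j μ ν + commErr L N Rc W y j μ ν = (1 : E →L[ℂ] E) (PhiFV L N Rc W x' ν) - PhiFV L N Rc W x ν := by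
      rw [geoV, h0, h1, h2, add_zero, add_zero, add_zero, one_apply_eq_self, hgx, hgx', PhiV_succ_sub L N Rc W hμν y j hlt]
    rw [hcD, cov_diff_split_frame (R' x μ) 1 (star (U' x)) (star (U' x')), mul_one, ← hmain, add_sub_cancel_left]
    exact (ContinuousLinearMap.le_opNorm _ _).trans (mul_le_mul_of_nonneg_right (hin y j μ hlt) (norm_nonneg _))
  · have heq : (j μ : ℕ) + 1 = L := by have := (j μ).is_lt; omega
    have hgx' : PhiFV L N Rc W x' ν = PhiV L N Rc W (y + unitVec N μ) (Function.update j μ 0) ν := by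
      rw [hx', bpt_add_unitVec_of_eq L N y j μ heq, PhiFV_bpt]
    have hmain : geoV L N Rc W y j μ ν + commErr L N Rc W y j μ ν = Rc y μ (PhiFV L N Rc W x' ν) - PhiFV L N Rc W x ν := by
      rw [geoV, hgx, hgx', Rc_PhiV_sub L N Rc W hμν y j heq]
    rw [hcD, cov_diff_split_frame (R' x μ) (Rc y μ) (star (U' x)) (star (U' x')), ← hmain, add_sub_cancel_left]
    exact (ContinuousLinearMap.le_opNorm _ _).trans (mul_le_mul_of_nonneg_right (hcross y j μ heq) (norm_nonneg _))

/-- **THE FINE COVARIANT CURL OF THE COMPETITOR, POINTWISE**: at `x = L·y + j`, for every `μ, ν`,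
`‖curl′_{R′}(Λ′)(x,μ,ν)‖ ≤ ‖geoV(μ,ν) − geoV(ν,μ)‖ + (‖commErr(μ,ν)‖ + ‖commErr(ν,μ)‖ + m·(‖Φ_ν(x+e_μ)‖ + ‖Φ_μ(x+e_ν)‖))`
(for `μ = ν` both sides of the curl cancel). [folklore] -/
theorem norm_curlV_interpV_le (hU : ∀ x, U' x ∈ unitary (E →L[ℂ] E)) (hm : 0 ≤ m)
    (hin : ∀ (y : Tor N) (j : Fin d → Fin L) (μ : Fin d), (j μ : ℕ) + 1 < L →
      ‖R' (bpt L N y j) μ * star (U' (bpt L N y j + unitVec (fine L N) μ)) - star (U' (bpt L N y j))‖ ≤ m)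
    (hcross : ∀ (y : Tor N) (j : Fin d → Fin L) (μ : Fin d), (j μ : ℕ) + 1 = L →
      ‖R' (bpt L N y j) μ * star (U' (bpt L N y j + unitVec (fine L N) μ)) - star (U' (bpt L N y j)) * Rc y μ‖ ≤ m)
    (y : Tor N) (j : Fin d → Fin L) (μ ν : Fin d) :
    ‖curlV (fine L N) R' (interpV L N U' Rc W) (bpt L N y j) μ ν‖
      ≤ ‖geoV L N Rc W y j μ ν - geoV L N Rc W y j ν μ‖
        + (‖commErr L N Rc W y j μ ν‖ + ‖commErr L N Rc W y j ν μ‖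
          + m * (‖PhiFV L N Rc W (bpt L N y j + unitVec (fine L N) μ) ν‖ + ‖PhiFV L N Rc W (bpt L N y j + unitVec (fine L N) ν) μ‖)) := by
  by_cases hμν : μ = ν
  · subst hμν
    have h0 : curlV (fine L N) R' (interpV L N U' Rc W) (bpt L N y j) μ μ = 0 := sub_self _
    rw [h0, norm_zero]
    positivity
  set x := bpt L N y j with hx
  set a : E := geoV L N Rc W y j μ ν + commErr L N Rc W y j μ ν with ha
  set b : E := geoV L N Rc W y j ν μ + commErr L N Rc W y j ν μ with hb
  set F₁ : E := cdV (fine L N) R' (interpV L N U' Rc W) x μ ν - star (U' x) a with hF₁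
  set F₂ : E := cdV (fine L N) R' (interpV L N U' Rc W) x ν μ - star (U' x) b with hF₂
  have h1 : ‖F₁‖ ≤ m * ‖PhiFV L N Rc W (bpt L N y j + unitVec (fine L N) μ) ν‖ := norm_frame_rem_le L N W hin hcross hμν y j
  have h2 : ‖F₂‖ ≤ m * ‖PhiFV L N Rc W (bpt L N y j + unitVec (fine L N) ν) μ‖ := norm_frame_rem_le L N W hin hcross (Ne.symm hμν) y j
  have hdec : curlV (fine L N) R' (interpV L N U' Rc W) x μ ν = star (U' x) (a - b) + (F₁ - F₂) := by
    simp only [curlV, hF₁, hF₂, map_sub]; abel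
  have hab : a - b = (geoV L N Rc W y j μ ν - geoV L N Rc W y j ν μ) + (commErr L N Rc W y j μ ν - commErr L N Rc W y j ν μ) := by
    rw [ha, hb]; abel
  rw [hdec]
  calc ‖star (U' x) (a - b) + (F₁ - F₂)‖ ≤ ‖star (U' x) (a - b)‖ + ‖F₁ - F₂‖ := norm_add_le _ _
    _ ≤ ‖a - b‖ + (‖F₁‖ + ‖F₂‖) := add_le_add (norm_star_apply_le (hU x) _) (norm_sub_le _ _)
    _ ≤ (‖geoV L N Rc W y j μ ν - geoV L N Rc W y j ν μ‖ + (‖commErr L N Rc W y j μ ν‖ + ‖commErr L N Rc W y j ν μ‖))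
        + (m * ‖PhiFV L N Rc W (bpt L N y j + unitVec (fine L N) μ) ν‖ + m * ‖PhiFV L N Rc W (bpt L N y j + unitVec (fine L N) ν) μ‖) := by
        refine add_le_add ?_ (add_le_add h1 h2)
        rw [hab]
        exact (norm_add_le _ _).trans (add_le_add le_rfl (norm_sub_le _ _))
    _ = _ := by ring

end Bonds

/-! ## §3 Sizes: the face terms and the interpolant -/

section Size

variable (L : ℕ) [NeZero L] (N : Fin d → ℕ) [∀ μ, NeZero (N μ)] (Rc : Tor N → Fin d → (E →L[ℂ] E)) (W : Tor N → Fin d → E)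

omit [NeZero L] [∀ μ, NeZero (N μ)] [CompleteSpace E] in
/-- `‖tiltErr(y,j,μ,ν)‖ ≤ [j_μ + 1 = L]·(5∕2)·‖(D_νD_μλ_ν)(y)‖`. [folklore] -/
theorem norm_tiltErr_le (y : Tor N) (j : Fin d → Fin L) (μ ν : Fin d) :
    ‖tiltErr L N Rc W y j μ ν‖
      ≤ (if (j μ : ℕ) + 1 = L then (1 : ℝ) else 0) * ((5 / 2) * ‖cDv N Rc (fun z => cDv N Rc (fun z => W z ν) z μ) y ν‖) := by
  unfold tiltErr
  split_ifs with h
  · rw [one_mul, norm_smul, Complex.norm_real, Real.norm_eq_abs]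
    exact mul_le_mul_of_nonneg_right (abs_lt_sub_wt_le L (j ν).is_lt) (norm_nonneg _)
  · simp

omit [NeZero L] [∀ μ, NeZero (N μ)] [CompleteSpace E] in
/-- `‖commErr(y,j,μ,ν)‖ ≤ [j_μ + 1 = L]·(5∕2)·p·‖λ_ν(y+e_μ+e_ν)‖` under the coarse plaquette defect `‖plaq(y,μ,ν)‖ ≤ p`. [folklore] -/
theorem norm_commErr_le {p : ℝ} (hp : ∀ y μ ν, ‖plaq N Rc y μ ν‖ ≤ p) (y : Tor N) (j : Fin d → Fin L) (μ ν : Fin d) :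
    ‖commErr L N Rc W y j μ ν‖
      ≤ (if (j μ : ℕ) + 1 = L then (1 : ℝ) else 0) * ((5 / 2) * (p * ‖W (y + unitVec N μ + unitVec N ν) ν‖)) := by
  have hp0 : 0 ≤ p := (norm_nonneg _).trans (hp y μ ν)
  unfold commErr
  split_ifs with h
  · rw [one_mul, norm_smul, Complex.norm_real, Real.norm_eq_abs]
    refine mul_le_mul (abs_lt_sub_wt_le L (j ν).is_lt) ?_ (norm_nonneg _) (by norm_num)
    exact (ContinuousLinearMap.le_opNorm _ _).trans (mul_le_mul_of_nonneg_right (hp y μ ν) (norm_nonneg _))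
  · simp

omit [NeZero L] [∀ μ, NeZero (N μ)] [CompleteSpace E] in
/-- `‖Φ_ν(y,j)‖ ≤ ‖Phiv(λ_ν)(y,j)‖ + (5∕2)(‖λ_ν(y+e_ν)‖ + ‖λ_ν(y)‖)` for contractive coarse operators. [folklore] -/
theorem norm_PhiV_le (hRc : ∀ y μ, ‖Rc y μ‖ ≤ 1) (y : Tor N) (j : Fin d → Fin L) (ν : Fin d) :
    ‖PhiV L N Rc W y j ν‖ ≤ ‖Phiv L N Rc (fun z => W z ν) y j‖ + (5 / 2) * (‖W (y + unitVec N ν) ν‖ + ‖W y ν‖) := by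
  unfold PhiV
  refine (norm_add_le _ _).trans (add_le_add le_rfl ?_)
  rw [norm_smul, Complex.norm_real, Real.norm_eq_abs]
  have hD : ‖cDv N Rc (fun z => W z ν) y ν‖ ≤ ‖W (y + unitVec N ν) ν‖ + ‖W y ν‖ := by
    unfold cDv
    refine (norm_sub_le _ _).trans (add_le_add ?_ le_rfl)
    exact (ContinuousLinearMap.le_opNorm _ _).trans (mul_le_of_le_one_left (norm_nonneg _) (hRc y ν))
  exact mul_le_mul (abs_lt_sub_wt_le L (j ν).is_lt) hD (norm_nonneg _) (by norm_num)

omit [CompleteSpace E] in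
/-- **SIZE OF THE INTERPOLANT, per component**: `Σ_x ‖Φ_ν(x)‖² ≤ (4(1+d²) + 50)·L^d·Σ_y‖λ_ν(y)‖²` (the 0-form count `sum_norm_sq_PhiFv_le` BY NAME plus the
longitudinal correction). [folklore] -/
theorem sum_norm_sq_PhiFV_le (hRc : ∀ y μ, ‖Rc y μ‖ ≤ 1) (ν : Fin d) :
    ∑ x, ‖PhiFV L N Rc W x ν‖ ^ 2 ≤ (4 * (1 + (d : ℝ) ^ 2) + 50) * ((L : ℝ) ^ d * ∑ y, ‖W y ν‖ ^ 2) := by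
  have hshift : ∑ y : Tor N, ‖W (y + unitVec N ν) ν‖ ^ 2 = ∑ y, ‖W y ν‖ ^ 2 :=
    Fintype.sum_equiv (Equiv.addRight (unitVec N ν)) _ _ fun y => rfl
  have hcardR : (Fintype.card (Fin d → Fin L) : ℝ) = (L : ℝ) ^ d := by
    rw [Fintype.card_fun, Fintype.card_fin, Fintype.card_fin]; push_cast; ring
  have h0 := sum_norm_sq_PhiFv_le L N Rc (fun z => W z ν) hRc
  rw [sum_blocks_real L N (fun x => ‖VariationalColourInterpolant.PhiFv L N Rc (fun z => W z ν) x‖ ^ 2)] at h0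
  simp only [VariationalColourInterpolant.PhiFv_bpt] at h0
  have hpt : ∀ (y : Tor N) (j : Fin d → Fin L), ‖PhiV L N Rc W y j ν‖ ^ 2
      ≤ 2 * ‖Phiv L N Rc (fun z => W z ν) y j‖ ^ 2 + 25 * (‖W (y + unitVec N ν) ν‖ ^ 2 + ‖W y ν‖ ^ 2) := by
    intro y j
    have h1 := norm_PhiV_le L N Rc W hRc y j ν
    have h2 := pow_le_pow_left₀ (norm_nonneg _) h1 2
    nlinarith [h2, sq_nonneg (‖Phiv L N Rc (fun z => W z ν) y j‖ - (5 / 2) * (‖W (y + unitVec N ν) ν‖ + ‖W y ν‖)),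
      sq_nonneg (‖W (y + unitVec N ν) ν‖ - ‖W y ν‖), norm_nonneg (Phiv L N Rc (fun z => W z ν) y j),
      norm_nonneg (W (y + unitVec N ν) ν), norm_nonneg (W y ν)]
  rw [sum_blocks_real L N (fun x => ‖PhiFV L N Rc W x ν‖ ^ 2)]
  simp only [PhiFV_bpt]
  calc ∑ y : Tor N, ∑ j : Fin d → Fin L, ‖PhiV L N Rc W y j ν‖ ^ 2
      ≤ ∑ y : Tor N, ∑ j : Fin d → Fin L, (2 * ‖Phiv L N Rc (fun z => W z ν) y j‖ ^ 2 + 25 * (‖W (y + unitVec N ν) ν‖ ^ 2 + ‖W y ν‖ ^ 2)) :=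
        sum_le_sum fun y _ => sum_le_sum fun j _ => hpt y j
    _ = 2 * ∑ y : Tor N, ∑ j : Fin d → Fin L, ‖Phiv L N Rc (fun z => W z ν) y j‖ ^ 2
        + 25 * ((Fintype.card (Fin d → Fin L) : ℝ) * (∑ y : Tor N, ‖W (y + unitVec N ν) ν‖ ^ 2 + ∑ y, ‖W y ν‖ ^ 2)) := by
        simp only [sum_add_distrib, sum_const, card_univ, nsmul_eq_mul, ← mul_sum]
        ring
    _ ≤ 2 * (2 * (1 + (d : ℝ) ^ 2) * ((L : ℝ) ^ d * ∑ y, ‖W y ν‖ ^ 2)) + 25 * ((L : ℝ) ^ d * (∑ y : Tor N, ‖W y ν‖ ^ 2 + ∑ y, ‖W y ν‖ ^ 2)) := by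
        rw [hshift, hcardR]; gcongr
    _ = _ := by ring

end Size

end Summit.QuantumFields.BalabanUV.T4Continuum.VariationalVectorOneStep

end
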